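import Mathlib
import HarnessLib
import Summits.AtomisticToContinuum.FouriersLaw.Theses.JunctionLocality
import Literature.MathematicalPhysics.KineticTheory.LangevinChainGibbs
import Summits.AtomisticToContinuum.FouriersLaw.Theorems.JunctionLocalitySuperadditiveResistanceKuboFrame
import Summits.AtomisticToContinuum.FouriersLaw.Theorems.JunctionLocalitySuperadditiveResistanceStubTerminationLocalityAux1
import Summits.AtomisticToContinuum.FouriersLaw.Theorems.JunctionLocalitySuperadditiveResistanceStubTerminationLocalityAux2
import Summits.AtomisticToContinuum.FouriersLaw.Theorems.JunctionLocalitySuperadditiveResistanceStubPlainForwardField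
import Summits.AtomisticToContinuum.FouriersLaw.Theorems.JunctionLocalitySuperadditiveResistanceTerminationJunctionLift
import Summits.AtomisticToContinuum.FouriersLaw.Theorems.JunctionLocalitySuperadditiveResistanceStubLinearResponsePlainAux2

/-!
# Termination locality, exact fixed-`N` identity — part II: the identity and the reduction of the stub
(stub `stub_terminationLocalityTC` of line `thermalise-then-cut-probe-insertion`, crux
`JunctionLocality.SuperadditiveResistance`, stmt-AtomisticToContinuum-11748)

The stub (TL⁺, skeleton v3): `∃ c ∀ N M ≥ 2`, along the crux's plain Kubo frames `PlainFrame P T L h_L (D L/(L−1))`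
and every Kubo frame `KuboFrame P T N M g gb₁ gb₄` of the γ-probed device,
`selfLeft g ≤ G_N(1 + cG_N)`, `selfRight g ≤ G_M(1 + cG_M)` (`G_L = D L/(L−1)`). Its `N`-uniform content
(renewal at a γ-thermostatted site, "double escape") is in no engine of the tree; this file proves the
EXACT FIXED-`N` IDENTITY that isolates it, in the v3 vocabulary, with nothing taken as a named fact:

* `defect_pairing` — the Green pairing across the junction: for a classical forward field `gb` of bath 1
  of the device and a classical forward field `g_N` of the bare `N`-piece, the defect `u = gb − g_N∘π_N`
  (defect equation `L_dev u = −V'(r_J)(∂_{p_{N−1}}g_N)∘π_N`, landed `deviceGenerator_defect`) has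
  `⟨u, p_0² − T⟩_{μ^{(N+M)}} = ⟨gb∘R, V'(r_J)(∂_{p_{N−1}}g_N)∘π_N⟩_{μ^{(N+M)}}` — the landed cross Green
  identity `Kubo.cross` (forward pair `u` against the backward pair `(gb∘R, p_0² − T)`), its `L²` input
  being part I (`…TerminationJunctionLift`: the junction Boltzmann factor tames `V'`);
* `terminationIdentity_left` (registered): with the Kubo link of the v3 plain frame
  (`G_N = γ(1/2 − ⟨p_0² − T, h_N⟩) = γ − (γ²/T²)⟨g_N, p_0² − T⟩`, the landed `kuboPairing_responseField`
  of `…StubLinearResponsePlainAux2`) and the `selfLeft` clause of `KuboFrame`,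
  `selfLeft g − G_N = −(γ²/T²)(S_N + Dyn_N)`,
  `S_N = ⟨g_N∘π_N, p_0²−T⟩_{μ^{(N+M)}} − ⟨g_N, p_0²−T⟩_{μ^{(N)}}` (STATIC: junction tilt of the left-block
  marginal; it VANISHES identically in every Gaussian-closed proxy, by Isserlis, since `p_0` is `N(0,T)` and
  independent of the rest under both Gibbs states),
  `Dyn_N = ⟨gb₁∘R, V'(q_N − q_{N−1})(∂_{p_{N−1}}g_N)∘π_N⟩_{μ^{(N+M)}}` (DYNAMIC). In the refuter's
  flip-noise harmonic bed (`Cruxes/SuperadditiveResistance/DREFUTE-BED.md`, `TLa = (a − G_N)/G_N² ≈ −1.9…−2.1`)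
  the whole column is therefore `−(γ²/T²)Dyn_N/G_N²`: `Dyn_N > 0` there (attachment LOWERS `L₁₁`), of size
  `≈ 2 (T²/γ²) G_N²`; the Ohmic caricature has the opposite sign; either is `O(G_N²)`;
* `terminationIdentity_right`: the mirror for `selfRight g`/the bare `M`-piece, from the left identity of
  the swapped split `(M, N)` (landed block swap `…StubTerminationLocalityAux2`; `gb₄∘Φ` is bath 1's field
  of the `(M, N)`-device, the `M`-piece enters through its LEFT forward field, as in its v3 plain frame);
* `stub_terminationLocalityTC_left_of_remainderBound`: the stub's left clause FOLLOWS from the `N`-uniform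
  one-sided bound `−(γ²/T²)(S_N + Dyn_N) ≤ c G_N²` over all frames and forward fields (the named bet
  `TerminationRemainderBound`; the right clause likewise from its mirror), using the landed existence of
  `g_N` (`stub_plainForwardField`). Conversely the identity shows the bet is implied by the stub, so the two
  are EQUIVALENT along the crux's frames: the stub is exactly an `N`-uniform estimate of `S_N + Dyn_N`.
-/

noncomputable section

open MeasureTheory Filter Topology ProbabilityTheory
open scoped ContDiff NNReal ENNReal
open Literature.MathematicalPhysics.KineticTheory.HeatConduction
open Summit.AtomisticToContinuum.FouriersLaw.Theorems.SuperadditiveResistance.DeviceLiouville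
  (liouvilleOp bathOp deviceWeight kin_eq_sq deviceGenerator_eq)
open Summit.AtomisticToContinuum.FouriersLaw.Theorems.SuperadditiveResistance.TerminationLocality
  (memLp_comp_restrictLeft)
open Summit.AtomisticToContinuum.FouriersLaw.Theorems.SuperadditiveResistance.Kubo
  (rev rev_apply contDiff_rev memLp_rev rev_pair cross memLp_partialP memLp_kinetic)

namespace Summit.AtomisticToContinuum.FouriersLaw.Cruxes.SuperadditiveResistance.ThermaliseThenCutProbeInsertion

/-- `kin L s = p_s²` for `s < L` (the line's `kin`, definitionally the copy of `…DeviceLiouville`). -/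
theorem kin_eq_sq_line {L s : ℕ} (hs : s < L) (x : PhaseSpace L) : kin L s x = x.2 ⟨s, hs⟩ ^ 2 :=
  kin_eq_sq hs x

/-- `kin` is even in the momenta. -/
theorem kin_neg_momentum {L : ℕ} (s : ℕ) (x : PhaseSpace L) : kin L s (x.1, -x.2) = kin L s x := by
  unfold kin
  simp

/-! ## The Green pairing across the junction -/

section Green

variable {ω₂ lam β : ℝ} {N M : ℕ}

open Summit.AtomisticToContinuum.FouriersLaw.Theorems.SuperadditiveResistance.TerminationLocality
  (restrictLeft contDiff_restrictLeft deviceGenerator_defect)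
open Summit.AtomisticToContinuum.FouriersLaw.Theorems.SuperadditiveResistance.DeviceLiouville
  (generator_eq_liouvilleOp_add)

/-- The device's thermostat weights are non-negative. -/
theorem deviceWeight_nonneg (N M : ℕ) (i : Fin (N + M)) : 0 ≤ deviceWeight N M i := by
  unfold deviceWeight OscillatorChain.bathWeight
  split_ifs <;> norm_num

/-- `∂_{p_{N−1}} g_N ∈ L²(μ_T^{(N)})` for a classical forward field of the bare `N`-chain (finite
entropy production at the γ-thermostatted end site; the landed energy estimate `Kubo.memLp_partialP`). -/
theorem memLp_partialP_plainField (hω : 0 < ω₂) (hl : 0 ≤ lam) (hβ : 0 ≤ β) {γ : ℝ} (hγ : 0 < γ)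
    (hN : 1 ≤ N) {T : ℝ} (hT : 0 < T) {gN : PhaseSpace N → ℝ} (hgC : ContDiff ℝ 2 gN)
    (hgL2 : MemLp gN 2 ((pinnedChain ω₂ lam β γ).gibbsMeasure N T))
    (hgpde : ∀ y, (pinnedChain ω₂ lam β γ).generator N T T gN y = -(kin N 0 y - T)) :
    MemLp (partialP ⟨N - 1, by omega⟩ gN) 2 ((pinnedChain ω₂ lam β γ).gibbsMeasure N T) := by
  have hpair : ∀ y, 1 * liouvilleOp (pinnedChain ω₂ lam β γ) N gN y + γ * bathOp N (OscillatorChain.bathWeight N) T gN y =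
      -(kin N 0 y - T) := by
    intro y
    rw [← hgpde y, generator_eq_liouvilleOp_add]
    have : (pinnedChain ω₂ lam β γ).γ = γ := rfl
    rw [this, one_mul]
  have hk : MemLp (fun y : PhaseSpace N => kin N 0 y - T) 2 ((pinnedChain ω₂ lam β γ).gibbsMeasure N T) := by
    have e : (fun y : PhaseSpace N => kin N 0 y - T) = fun y => y.2 ⟨0, by omega⟩ ^ 2 - T := by
      funext y; rw [kin_eq_sq_line (show 0 < N by omega)]
    rw [e]; exact memLp_kinetic (γ := γ) hω hl hβ N hT ⟨0, by omega⟩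
  have hB : ∀ i : Fin N, 0 ≤ OscillatorChain.bathWeight N i := fun i => by
    unfold OscillatorChain.bathWeight; split_ifs <;> norm_num
  have hi : 0 < OscillatorChain.bathWeight N ⟨N - 1, by omega⟩ := by
    unfold OscillatorChain.bathWeight
    simp
    split_ifs <;> norm_num
  exact memLp_partialP hω hl hβ γ N hT _ hB 1 hγ hgC hgL2 hk hpair hi

/-- **The Green pairing across the junction (fixed `N`, `M`; exact).** For the pinned chain
(all parameters `> 0`, `T > 0`, `N, M ≥ 1`), a classical forward field `gb` of bath 1 of the
`(N, M)`-device (`C² ∩ L²(μ_T^{(N+M)})`, `L_dev gb = −(p_0² − T)` with all four thermostats at `T`) and a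
classical forward field `g_N` of the bare `N`-chain (`C² ∩ L²(μ_T^{(N)})`, `L_N^{T,T} g_N = −(p_0² − T)`),
the defect `u = gb − g_N ∘ π_N` has return pairing
`⟨u, p_0² − T⟩_{μ^{(N+M)}} = ⟨gb∘R, V'(q_N − q_{N−1}) · (∂_{p_{N−1}} g_N)∘π_N⟩_{μ^{(N+M)}}`
(`R` the momentum reversal, `V'(r) = r + βr³`): the cross Green identity of the landed Kubo toolkit
for the forward pair `(u, V'(r_J)(∂_{p_{N−1}}g_N)∘π_N)` (the defect equation) against the backward pair
`(gb∘R, p_0² − T)`; the source `V'(r_J)(∂_{p_{N−1}}g_N)∘π_N` is in `L²` because the junction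
Boltzmann factor tames `V'` (`memLp_junctionForce_mul_comp_restrictLeft`). -/
theorem defect_pairing (hω : 0 < ω₂) (hl : 0 ≤ lam) (hβ : 0 ≤ β) {γ : ℝ} (hγ : 0 < γ)
    (hN : 1 ≤ N) (hM : 1 ≤ M) {T : ℝ} (hT : 0 < T)
    {gb : PhaseSpace (N + M) → ℝ} (hbC : ContDiff ℝ 2 gb) (hbL2 : MemLp gb 2 ((pinnedChain ω₂ lam β γ).gibbsMeasure (N + M) T))
    (hbpde : ∀ x, deviceGenerator (pinnedChain ω₂ lam β γ) N M (fun _ => T) gb x = -(kin (N + M) 0 x - T))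
    {gN : PhaseSpace N → ℝ} (hgC : ContDiff ℝ 2 gN) (hgL2 : MemLp gN 2 ((pinnedChain ω₂ lam β γ).gibbsMeasure N T))
    (hgpde : ∀ y, (pinnedChain ω₂ lam β γ).generator N T T gN y = -(kin N 0 y - T)) :
    ∫ x, (gb x - gN (x.1 ∘ Fin.castAdd M, x.2 ∘ Fin.castAdd M)) * (kin (N + M) 0 x - T)
        ∂((pinnedChain ω₂ lam β γ).gibbsMeasure (N + M) T) =
      ∫ x, gb (x.1, -x.2) *
        (((x.1 ⟨N, by omega⟩ - x.1 ⟨N - 1, by omega⟩) + β * (x.1 ⟨N, by omega⟩ - x.1 ⟨N - 1, by omega⟩) ^ 3) *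
          partialP ⟨N - 1, by omega⟩ gN (x.1 ∘ Fin.castAdd M, x.2 ∘ Fin.castAdd M))
        ∂((pinnedChain ω₂ lam β γ).gibbsMeasure (N + M) T) := by
  set μ := (pinnedChain ω₂ lam β γ).gibbsMeasure (N + M) T with hμ
  -- the defect and its source
  set u : PhaseSpace (N + M) → ℝ := fun y => gb y - gN (restrictLeft N M y) with hu
  set ku : PhaseSpace (N + M) → ℝ := fun x =>
    (((x.1 ⟨N, by omega⟩ - x.1 ⟨N - 1, by omega⟩) + β * (x.1 ⟨N, by omega⟩ - x.1 ⟨N - 1, by omega⟩) ^ 3) *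
      partialP ⟨N - 1, by omega⟩ gN (restrictLeft N M x)) with hku
  have hgNπ : ContDiff ℝ 2 (gN ∘ restrictLeft N M) := hgC.comp contDiff_restrictLeft
  have huC : ContDiff ℝ 2 u := hbC.sub hgNπ
  have huL2 : MemLp u 2 μ := hbL2.sub (memLp_comp_restrictLeft hω hl hβ γ hN hM hT hgL2)
  -- the defect equation in pair form
  have hdef := deviceGenerator_defect ω₂ lam β γ T hN hM hbC hgC (fun x => hbpde x) hgpde
  have hpair_u : ∀ x, 1 * liouvilleOp (pinnedChain ω₂ lam β γ) (N + M) u x + γ * bathOp (N + M) (deviceWeight N M) T u x = -ku x := by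
    intro x
    have h1 := hdef x
    rw [deviceGenerator_eq] at h1
    have : (pinnedChain ω₂ lam β γ).γ = γ := rfl
    rw [this] at h1
    rw [one_mul]
    exact h1
  -- the backward pair `(gb∘R, p_0² − T)`
  have hpair_b : ∀ x, 1 * liouvilleOp (pinnedChain ω₂ lam β γ) (N + M) gb x + γ * bathOp (N + M) (deviceWeight N M) T gb x =
      -(kin (N + M) 0 x - T) := by
    intro x
    have h1 := hbpde x
    have e : deviceGenerator (pinnedChain ω₂ lam β γ) N M (fun _ => T) gb x =
        Summit.AtomisticToContinuum.FouriersLaw.Theorems.SuperadditiveResistance.DeviceLiouville.deviceGenerator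
          (pinnedChain ω₂ lam β γ) N M (fun _ => T) gb x := rfl
    rw [e, deviceGenerator_eq] at h1
    have : (pinnedChain ω₂ lam β γ).γ = γ := rfl
    rw [this] at h1
    rw [one_mul]
    exact h1
  have hpair_rev : ∀ x, -1 * liouvilleOp (pinnedChain ω₂ lam β γ) (N + M) (rev gb) x +
      γ * bathOp (N + M) (deviceWeight N M) T (rev gb) x = -(kin (N + M) 0 x - T) := by
    intro x
    have h := rev_pair (pinnedChain ω₂ lam β γ) (deviceWeight N M) T 1 γ hpair_b x
    rw [h, rev_apply, kin_neg_momentum]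
  -- regularity
  have hrevC : ContDiff ℝ 2 (rev gb) := contDiff_rev hbC
  have hrevL2 : MemLp (rev gb) 2 μ := memLp_rev hω hl hβ (N + M) hT hbC.continuous hbL2
  have hk0 : MemLp (fun x : PhaseSpace (N + M) => kin (N + M) 0 x - T) 2 μ := by
    have e : (fun x : PhaseSpace (N + M) => kin (N + M) 0 x - T) = fun x => x.2 ⟨0, by omega⟩ ^ 2 - T := by
      funext x; rw [kin_eq_sq_line (show 0 < N + M by omega)]
    rw [e]; exact memLp_kinetic (γ := γ) hω hl hβ (N + M) hT ⟨0, by omega⟩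
  have hdgN : MemLp (partialP ⟨N - 1, by omega⟩ gN) 2 ((pinnedChain ω₂ lam β γ).gibbsMeasure N T) :=
    memLp_partialP_plainField hω hl hβ hγ hN hT hgC hgL2 hgpde
  have hkuL2 : MemLp ku 2 μ :=
    memLp_junctionForce_mul_comp_restrictLeft hω hl hβ γ hN hM hT
      (continuous_partialP (hgC.of_le (by norm_cast) : ContDiff ℝ 1 gN) one_ne_zero _) hdgN
  -- the cross Green identity
  have hcross := cross hω hl hβ (N + M) hT (deviceWeight N M) (deviceWeight_nonneg N M) 1 hγ
    huC hrevC huL2 hrevL2 hkuL2 hk0 hpair_u hpair_rev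
  -- back to the Gibbs measure
  rw [(pinnedChain ω₂ lam β γ).integral_gibbsMeasure, (pinnedChain ω₂ lam β γ).integral_gibbsMeasure]
  congr 1
  have e1 : (fun x => (gb x - gN (x.1 ∘ Fin.castAdd M, x.2 ∘ Fin.castAdd M)) * (kin (N + M) 0 x - T) *
      (pinnedChain ω₂ lam β γ).gibbsDensity (N + M) T x) = fun x => u x * (kin (N + M) 0 x - T) * (pinnedChain ω₂ lam β γ).gibbsDensity (N + M) T x := rfl
  have e2 : (fun x => gb (x.1, -x.2) *
      (((x.1 ⟨N, by omega⟩ - x.1 ⟨N - 1, by omega⟩) + β * (x.1 ⟨N, by omega⟩ - x.1 ⟨N - 1, by omega⟩) ^ 3) *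
        partialP ⟨N - 1, by omega⟩ gN (x.1 ∘ Fin.castAdd M, x.2 ∘ Fin.castAdd M)) *
      (pinnedChain ω₂ lam β γ).gibbsDensity (N + M) T x) = fun x => rev gb x * ku x * (pinnedChain ω₂ lam β γ).gibbsDensity (N + M) T x := rfl
  rw [e1, e2, hcross]

end Green

/-! ## The termination identity (left block) and the reduction of the stub to the remainder bound -/

section Identity

/-- **TERMINATION IDENTITY, left block (fixed `N`, `M`; exact; v3 vocabulary).** Under the plain
Kubo frame `PlainFrame P T N h G_N` of the bare `N`-piece (v3: `h` its `L²`-weak antisymmetric-bias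
response field, `G_N = γ(1/2 − ⟨p_0² − T, h⟩)`, in the line `G_N = D N/(N−1)`) and the equilibrium
Kubo frame `KuboFrame P T N M g gb₁ gb₄` of the γ-probed device, for EVERY classical forward
field `g_N ∈ C² ∩ L²(μ_T^{(N)})` of the bare piece's left bath (`L_N^{T,T} g_N = −(p_0² − T)`; one
exists by the landed `stub_plainForwardField`; `⟨p_0² − T, h⟩ = (γ/T²)⟨g_N, p_0² − T⟩ − 1/2` by the
landed `kuboPairing_responseField`):

  `L₁₁ − G_N = selfLeft g − G_N = −(γ²/T²) · (S_N + Dyn_N)`,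
  `S_N   = ⟨g_N∘π_N, p_0² − T⟩_{μ^{(N+M)}} − ⟨g_N, p_0² − T⟩_{μ^{(N)}}`   (STATIC: the junction bond tilts
          the left-block marginal of the device's Gibbs state by a function of `q_{N−1}`),
  `Dyn_N = ⟨gb₁∘R, V'(q_N − q_{N−1}) · (∂_{p_{N−1}} g_N)∘π_N⟩_{μ^{(N+M)}}`   (DYNAMIC: device backward
          field × junction force × momentum gradient of the bare field at its γ-thermostatted end).

So TL⁺ (`selfLeft g ≤ G_N(1 + c G_N)`, `N`-uniform) is EQUIVALENT to the `N`-uniform one-sided bound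
`−(γ²/T²)(S_N + Dyn_N) ≤ c G_N²` (`stub_terminationLocalityTC_left_of_remainderBound`). -/
theorem terminationIdentity_left : ∀ (ω₂ lam β γ T : ℝ), 0 < ω₂ → 0 ≤ lam → 0 < β → 0 < γ → 0 < T → ∀ (N M : ℕ) (hN : 1 ≤ N) (hM : 1 ≤ M) (h : PhaseSpace N → ℝ) (G : ℝ) (g : Fin 4 → Fin 4 → ℝ) (gb₁ gb₄ : PhaseSpace (N + M) → ℝ) (gN : PhaseSpace N → ℝ), PlainFrame (pinnedChain ω₂ lam β γ) T N h G → KuboFrame (pinnedChain ω₂ lam β γ) T N M g gb₁ gb₄ → ContDiff ℝ 2 gN → MemLp gN 2 ((pinnedChain ω₂ lam β γ).gibbsMeasure N T) → (∀ y, (pinnedChain ω₂ lam β γ).generator N T T gN y = -(kin N 0 y - T)) → selfLeft g - G = -(γ ^ 2 / T ^ 2) * (((∫ x, gN (x.1 ∘ Fin.castAdd M, x.2 ∘ Fin.castAdd M) * (kin (N + M) 0 x - T) ∂((pinnedChain ω₂ lam β γ).gibbsMeasure (N + M) T)) - ∫ y, gN y * (kin N 0 y - T) ∂((pinnedChain ω₂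 lam β γ).gibbsMeasure N T)) + ∫ x, gb₁ (x.1, -x.2) * (((x.1 ⟨N, by omega⟩ - x.1 ⟨N - 1, by omega⟩) + β * (x.1 ⟨N, by omega⟩ - x.1 ⟨N - 1, by omega⟩) ^ 3) * partialP ⟨N - 1, by omega⟩ gN (x.1 ∘ Fin.castAdd M, x.2 ∘ Fin.castAdd M)) ∂((pinnedChain ω₂ lam β γ).gibbsMeasure (N + M) T)) := by
  intro ω₂ lam β γ T hω hl hβ hγ hT N M hN hM h G g gb₁ gb₄ gN hPF hKF hgC hgL2 hgpde
  set P := pinnedChain ω₂ lam β γ with hP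
  obtain ⟨-, -, hff, -, -, hself, -, -⟩ := hKF
  obtain ⟨hbC, hbL2, -, -, hbpde⟩ := hff
  -- the Kubo link of the v3 plain frame: `G = γ − (γ²/T²)⟨g_N, p_0² − T⟩`
  obtain ⟨hh, -, hG0⟩ := hPF
  have hG : G = γ - γ ^ 2 / T ^ 2 * ∫ y, gN y * (kin N 0 y - T) ∂(P.gibbsMeasure N T) := by
    rw [hG0, kuboPairing_responseField hω hl hβ hγ (show 0 < N by omega) hT hh hgC hgL2 hgpde]
    have : P.γ = γ := rfl
    rw [this]
    ring
  have hD := defect_pairing hω hl hβ.le hγ hN hM hT hbC hbL2 hbpde hgC hgL2 hgpde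
  -- split `⟨gb₁, p_0² − T⟩ = ⟨u, p_0² − T⟩ + ⟨g_N∘π_N, p_0² − T⟩`
  have hk0 : MemLp (fun x : PhaseSpace (N + M) => kin (N + M) 0 x - T) 2 (P.gibbsMeasure (N + M) T) := by
    have e : (fun x : PhaseSpace (N + M) => kin (N + M) 0 x - T) = fun x => x.2 ⟨0, by omega⟩ ^ 2 - T := by
      funext x; rw [kin_eq_sq_line (show 0 < N + M by omega)]
    rw [e]; exact memLp_kinetic (γ := γ) hω hl hβ.le (N + M) hT ⟨0, by omega⟩
  have hgNπ : MemLp (fun x : PhaseSpace (N + M) => gN (x.1 ∘ Fin.castAdd M, x.2 ∘ Fin.castAdd M)) 2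
      (P.gibbsMeasure (N + M) T) := memLp_comp_restrictLeft hω hl hβ.le γ hN hM hT hgL2
  have hI1 : Integrable (fun x => (gb₁ x - gN (x.1 ∘ Fin.castAdd M, x.2 ∘ Fin.castAdd M)) *
      (kin (N + M) 0 x - T)) (P.gibbsMeasure (N + M) T) := (hbL2.sub hgNπ).integrable_mul hk0
  have hI2 : Integrable (fun x => gN (x.1 ∘ Fin.castAdd M, x.2 ∘ Fin.castAdd M) * (kin (N + M) 0 x - T))
      (P.gibbsMeasure (N + M) T) := hgNπ.integrable_mul hk0
  have hsplit : ∫ x, gb₁ x * (kin (N + M) 0 x - T) ∂(P.gibbsMeasure (N + M) T) =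
      (∫ x, (gb₁ x - gN (x.1 ∘ Fin.castAdd M, x.2 ∘ Fin.castAdd M)) * (kin (N + M) 0 x - T)
        ∂(P.gibbsMeasure (N + M) T)) +
        ∫ x, gN (x.1 ∘ Fin.castAdd M, x.2 ∘ Fin.castAdd M) * (kin (N + M) 0 x - T) ∂(P.gibbsMeasure (N + M) T) := by
    rw [← integral_add hI1 hI2]
    exact integral_congr_ae (ae_of_all _ fun x => by ring)
  rw [hself, hG, hsplit, hD]
  have : P.γ = γ := rfl
  rw [this]
  ring

/-- **Reduction of the stub's left clause to the remainder bound.** If the termination remainder is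
bounded one-sidedly and `N`-uniformly — `∃ c, ∀ N M ≥ 2, ∀ frames, ∀ forward fields g_N,
−(γ²/T²)(S_N + Dyn_N) ≤ c · G_N²` (the named bet `TerminationRemainderBound`, left block) — then the
left clause of `stub_terminationLocalityTC` holds with the same constant: `selfLeft g ≤ G_N (1 + c G_N)`
along the crux's plain Kubo frames (`G_N = D N/(N−1)`), by `terminationIdentity_left` and the landed
existence of `g_N` (`stub_plainForwardField`). -/
theorem stub_terminationLocalityTC_left_of_remainderBound : ∀ (ω₂ lam β γ T : ℝ), 0 < ω₂ → 0 < lam → 0 < β → 0 < γ → 0 < T → ∀ (D : ℕ → ℝ) (c : ℝ), (∀ (N M : ℕ) (hN : 2 ≤ N) (hM : 2 ≤ M) (h : PhaseSpace N → ℝ) (g : Fin 4 → Fin 4 → ℝ) (gb₁ gb₄ : PhaseSpace (N + M) → ℝ) (gN : PhaseSpace N → ℝ), PlainFrame (pinnedChain ω₂ lam β γ) T N h (D N / ((N : ℝ) - 1)) → KuboFrame (pinnedChain ω₂ lam β γ) T N M g gb₁ gb₄ → ContDiff ℝ 2 gN → MemLp gN 2 ((pinnedChain ω₂ lam β γ).gibbsMeasure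 N T) → (∀ y, (pinnedChain ω₂ lam β γ).generator N T T gN y = -(kin N 0 y - T)) → -(γ ^ 2 / T ^ 2) * (((∫ x, gN (x.1 ∘ Fin.castAdd M, x.2 ∘ Fin.castAdd M) * (kin (N + M) 0 x - T) ∂((pinnedChain ω₂ lam β γ).gibbsMeasure (N + M) T)) - ∫ y, gN y * (kin N 0 y - T) ∂((pinnedChain ω₂ lam β γ).gibbsMeasure N T)) + ∫ x, gb₁ (x.1, -x.2) * (((x.1 ⟨N, by omega⟩ - x.1 ⟨N - 1, by omega⟩) + β * (x.1 ⟨N, by omega⟩ - x.1 ⟨N - 1, by omega⟩) ^ 3) * partialP ⟨N - 1, by omega⟩ gN (x.1 ∘ Fin.castAdd M, x.2 ∘ Fin.castAdd M)) ∂((pinnedChain ω₂ lam β γ).gibbsMeasure (N + M) T)) ≤ c * (D N / ((N : ℝ) - 1)) ^ 2) → ∀ (N M : ℕ), 2 ≤ N → 2 ≤ M → ∀ (h : PhaseSpace N → ℝ) (g : Fin 4 → Fin 4 → ℝ) (gb₁ gb₄ : PhaseSpace (N + M) → ℝ), PlainFrame (pinnedChain ω₂ lam β γ) T N h (D N / ((N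 : ℝ) - 1)) → KuboFrame (pinnedChain ω₂ lam β γ) T N M g gb₁ gb₄ → selfLeft g ≤ D N / ((N : ℝ) - 1) * (1 + c * (D N / ((N : ℝ) - 1))) := by
  intro ω₂ lam β γ T hω hlam hβ hγ hT D c hRB N M hN hM h g gb₁ gb₄ hPF hKF
  obtain ⟨gN, hgC, hgL2, -, hgpde⟩ :=
    FloatingProbeBypassLaplacian.stub_plainForwardField ω₂ lam β γ T hω hlam hβ hγ hT N hN
  have hid := terminationIdentity_left ω₂ lam β γ T hω hlam.le hβ hγ hT N M (by omega) (by omega) h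
    (D N / ((N : ℝ) - 1)) g gb₁ gb₄ gN hPF hKF hgC hgL2 (fun y => hgpde y)
  have hb := hRB N M hN hM h g gb₁ gb₄ gN hPF hKF hgC hgL2 (fun y => hgpde y)
  have e : selfLeft g = D N / ((N : ℝ) - 1) + (selfLeft g - D N / ((N : ℝ) - 1)) := by ring
  rw [e, hid]
  nlinarith [hb]

end Identity

/-! ## The mirror identity (right block) by the block swap -/

section Mirror

open Summit.AtomisticToContinuum.FouriersLaw.Theorems.SuperadditiveResistance.TerminationLocality
  (blockSwap blockSwap_fst blockSwap_snd swapIdx_val kin_blockSwap deviceGenerator_comp_blockSwap_const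
    integral_gibbsMeasure_comp_blockSwap memLp_comp_blockSwap pinnedChain_V_even)

/-- **TERMINATION IDENTITY, right block (fixed `N`, `M`; exact; v3 vocabulary).** The mirror of
`terminationIdentity_left` for `L₄₄ = selfRight g` and the bare `M`-piece, obtained from the left
identity of the SWAPPED split `(M, N)`: the site reversal `Φ : (q, p) ↦ (q ∘ σ, p ∘ σ)`,
`σ i = M+N−1−i`, maps the `(M, N)`-device onto the `(N, M)`-device, `gb₄ ∘ Φ` is the bath-1 forward
field of the `(M, N)`-device, and the bare `M`-piece enters through the forward field `g_M` of its LEFT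
bath (the v3 plain frame at `L = M`): `selfRight g − G_M = −(γ²/T²)(S_M + Dyn_M)` with
`S_M = ⟨g_M∘π_M, p_0² − T⟩_{μ^{(M+N)}} − ⟨g_M, p_0² − T⟩_{μ^{(M)}}`,
`Dyn_M = ⟨(gb₄∘Φ)∘R, V'(q_M − q_{M−1})(∂_{p_{M−1}} g_M)∘π_M⟩_{μ^{(M+N)}}` (all on the swapped device). -/
theorem terminationIdentity_right : ∀ (ω₂ lam β γ T : ℝ), 0 < ω₂ → 0 ≤ lam → 0 < β → 0 < γ → 0 < T → ∀ (N M : ℕ) (hN : 1 ≤ N) (hM : 1 ≤ M) (h : PhaseSpace M → ℝ) (G : ℝ) (g : Fin 4 → Fin 4 → ℝ) (gb₁ gb₄ : PhaseSpace (N + M) → ℝ) (gM : PhaseSpace M → ℝ), PlainFrame (pinnedChain ω₂ lam β γ) T M h G → KuboFrame (pinnedChain ω₂ lam β γ) T N M g gb₁ gb₄ → ContDiff ℝ 2 gM → MemLp gM 2 ((pinnedChain ω₂ lam β γ).gibbsMeasure M T) → (∀ y, (pinnedChain ω₂ lam β γ).generator M T T gM y = -(kin M 0 y - T)) → selfRight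 g - G = -(γ ^ 2 / T ^ 2) * (((∫ z, gM (z.1 ∘ Fin.castAdd N, z.2 ∘ Fin.castAdd N) * (kin (M + N) 0 z - T) ∂((pinnedChain ω₂ lam β γ).gibbsMeasure (M + N) T)) - ∫ y, gM y * (kin M 0 y - T) ∂((pinnedChain ω₂ lam β γ).gibbsMeasure M T)) + ∫ z, gb₄ ((fun i : Fin (N + M) => z.1 ⟨M + N - 1 - i.val, by omega⟩), (fun i : Fin (N + M) => -z.2 ⟨M + N - 1 - i.val, by omega⟩)) * (((z.1 ⟨M, by omega⟩ - z.1 ⟨M - 1, by omega⟩) + β * (z.1 ⟨M, by omega⟩ - z.1 ⟨M - 1, by omega⟩) ^ 3) * partialP ⟨M - 1, by omega⟩ gM (z.1 ∘ Fin.castAdd N, z.2 ∘ Fin.castAdd N)) ∂((pinnedChain ω₂ lam β γ).gibbsMeasure (M + N) T)) := by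
  intro ω₂ lam β γ T hω hl hβ' hγ hT N M hN hM h G g gb₁ gb₄ gM hPF hKF hgC hgL2 hgpde
  have hβ : 0 ≤ β := hβ'.le
  set P := pinnedChain ω₂ lam β γ with hP
  have hV : ∀ r, P.V (-r) = P.V r := pinnedChain_V_even ω₂ lam β γ
  obtain ⟨-, -, -, hff, -, -, -, hself⟩ := hKF
  obtain ⟨hbC, hbL2, -, -, hbpde⟩ := hff
  -- the swapped forward field `gb₄ ∘ Φ` of bath 1 of the `(M, N)`-device
  set gb : PhaseSpace (M + N) → ℝ := gb₄ ∘ blockSwap M N with hgb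
  have hbC' : ContDiff ℝ 2 gb := hbC.comp (blockSwap M N).contDiff
  have hbL2' : MemLp gb 2 (P.gibbsMeasure (M + N) T) := memLp_comp_blockSwap P hV T hbL2
  have hbpde' : ∀ z, deviceGenerator P M N (fun _ => T) gb z = -(kin (M + N) 0 z - T) := by
    intro z
    have e1 : deviceGenerator P M N (fun _ => T) gb z =
        Summit.AtomisticToContinuum.FouriersLaw.Theorems.SuperadditiveResistance.DeviceLiouville.deviceGenerator
          P M N (fun _ => T) (gb₄ ∘ blockSwap M N) z := rfl
    have e2 := deviceGenerator_comp_blockSwap_const P hV hM hN T gb₄ z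
    have e3 : Summit.AtomisticToContinuum.FouriersLaw.Theorems.SuperadditiveResistance.DeviceLiouville.deviceGenerator
          P N M (fun _ => T) gb₄ (blockSwap M N z) = deviceGenerator P N M (fun _ => T) gb₄ (blockSwap M N z) := rfl
    have e4 := kin_blockSwap (N := M) (M := N) (s := 0) (s' := N + M - 1) (by omega) (by omega) z
    rw [e1, e2, e3, hbpde]
    exact congrArg (fun t => -(t - T)) e4
  -- the Kubo link of the v3 plain frame of the `M`-piece
  obtain ⟨hh, -, hG0⟩ := hPF
  have hG : G = γ - γ ^ 2 / T ^ 2 * ∫ y, gM y * (kin M 0 y - T) ∂(P.gibbsMeasure M T) := by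
    rw [hG0, kuboPairing_responseField hω hl hβ' hγ (show 0 < M by omega) hT hh hgC hgL2 hgpde]
    have : P.γ = γ := rfl
    rw [this]
    ring
  have hD := defect_pairing hω hl hβ hγ hM hN hT hbC' hbL2' hbpde' hgC hgL2 hgpde
  -- the return pairing of bath 4 on the swapped device
  have hswap : ∫ x, gb₄ x * (kin (N + M) (N + M - 1) x - T) ∂(P.gibbsMeasure (N + M) T) =
      ∫ z, gb z * (kin (M + N) 0 z - T) ∂(P.gibbsMeasure (M + N) T) := by
    rw [← integral_gibbsMeasure_comp_blockSwap P hV T (fun x => gb₄ x * (kin (N + M) (N + M - 1) x - T))]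
    refine integral_congr_ae (ae_of_all _ fun z => ?_)
    have e4 := kin_blockSwap (N := M) (M := N) (s := 0) (s' := N + M - 1) (by omega) (by omega) z
    dsimp only
    rw [show Summit.AtomisticToContinuum.FouriersLaw.Theorems.SuperadditiveResistance.DeviceLiouville.kin
      (N + M) (N + M - 1) (blockSwap M N z) = kin (N + M) (N + M - 1) (blockSwap M N z) from rfl] at e4
    rw [e4]
    rfl
  -- split `⟨gb, p_0² − T⟩ = ⟨u, p_0² − T⟩ + ⟨g_M∘π_M, p_0² − T⟩`
  have hk0 : MemLp (fun z : PhaseSpace (M + N) => kin (M + N) 0 z - T) 2 (P.gibbsMeasure (M + N) T) := by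
    have e : (fun z : PhaseSpace (M + N) => kin (M + N) 0 z - T) = fun z => z.2 ⟨0, by omega⟩ ^ 2 - T := by
      funext z; rw [kin_eq_sq_line (show 0 < M + N by omega)]
    rw [e]; exact memLp_kinetic (γ := γ) hω hl hβ (M + N) hT ⟨0, by omega⟩
  have hgMπ : MemLp (fun z : PhaseSpace (M + N) => gM (z.1 ∘ Fin.castAdd N, z.2 ∘ Fin.castAdd N)) 2
      (P.gibbsMeasure (M + N) T) := memLp_comp_restrictLeft hω hl hβ γ hM hN hT hgL2
  have hI1 : Integrable (fun z => (gb z - gM (z.1 ∘ Fin.castAdd N, z.2 ∘ Fin.castAdd N)) *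
      (kin (M + N) 0 z - T)) (P.gibbsMeasure (M + N) T) := (hbL2'.sub hgMπ).integrable_mul hk0
  have hI2 : Integrable (fun z => gM (z.1 ∘ Fin.castAdd N, z.2 ∘ Fin.castAdd N) * (kin (M + N) 0 z - T))
      (P.gibbsMeasure (M + N) T) := hgMπ.integrable_mul hk0
  have hsplit : ∫ z, gb z * (kin (M + N) 0 z - T) ∂(P.gibbsMeasure (M + N) T) =
      (∫ z, (gb z - gM (z.1 ∘ Fin.castAdd N, z.2 ∘ Fin.castAdd N)) * (kin (M + N) 0 z - T)
        ∂(P.gibbsMeasure (M + N) T)) +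
        ∫ z, gM (z.1 ∘ Fin.castAdd N, z.2 ∘ Fin.castAdd N) * (kin (M + N) 0 z - T) ∂(P.gibbsMeasure (M + N) T) := by
    rw [← integral_add hI1 hI2]
    exact integral_congr_ae (ae_of_all _ fun z => by ring)
  rw [hself, hswap, hG, hsplit, hD]
  have : P.γ = γ := rfl
  rw [this]
  have eD : ∫ z, gb (z.1, -z.2) *
      (((z.1 ⟨M, by omega⟩ - z.1 ⟨M - 1, by omega⟩) + β * (z.1 ⟨M, by omega⟩ - z.1 ⟨M - 1, by omega⟩) ^ 3) *
        partialP ⟨M - 1, by omega⟩ gM (z.1 ∘ Fin.castAdd N, z.2 ∘ Fin.castAdd N)) ∂(P.gibbsMeasure (M + N) T) =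
      ∫ z, gb₄ ((fun i : Fin (N + M) => z.1 ⟨M + N - 1 - i.val, by omega⟩),
          (fun i : Fin (N + M) => -z.2 ⟨M + N - 1 - i.val, by omega⟩)) *
        (((z.1 ⟨M, by omega⟩ - z.1 ⟨M - 1, by omega⟩) + β * (z.1 ⟨M, by omega⟩ - z.1 ⟨M - 1, by omega⟩) ^ 3) *
          partialP ⟨M - 1, by omega⟩ gM (z.1 ∘ Fin.castAdd N, z.2 ∘ Fin.castAdd N)) ∂(P.gibbsMeasure (M + N) T) := by
    rfl
  rw [eD]
  ring

end Mirror

end Summit.AtomisticToContinuum.FouriersLaw.Cruxes.SuperadditiveResistance.ThermaliseThenCutProbeInsertion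

end
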